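/-
Copyright (c) 2026 the pub-hodgecm-mathlib formalisation cell (harness21).  Prover seat hodgecm-mathlib-K2Liu-p02 (g5), Track B «K2-LIT» ∕ hLiu418
#184♮, Road I v3, organ U2f (LEAD F0P6-plan (g12) 07:59:57Z «CENSUS-FIRST the fin-half tmul compatibility; if it is a missing S-brick, file it first»).  2026-09-04.
-/
import Literature.NumberTheory.GelbartRogawski1991.UnitaryDualPairWeilCoinvariantsSmooth     -- ★ engine `WeilCoinv.exists_finCongruenceLevel_forall_finRepMp_apply_eq_self`
import Literature.NumberTheory.GelbartRogawski1991.DoubledWeilRepresentationUniqueness      -- ★ `DoubledWeilUniqueness.isUnit_gramDA`, doubled data `HA ∕ MpD ∕ toSpD ∕ IsDoubledWeilRep`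
import Literature.NumberTheory.Automorphic.UnitaryGroupSymplecticFiniteAdelic                -- ★ `adelicToSymplectic_finAdelicToAdelic_apply_eq_self`
import Literature.NumberTheory.Automorphic.UnitaryGroupAdelicProduct                         -- ★ `archToAdelic ∕ finAdelicToAdelic ∕ archPart ∕ finPart`
import HarnessLib

/-!
# K2_Liu road (hLiu418 = stmt-HodgeConjecture-24832), Road I v3 organ U2f, S-brick: THE FINITE HALF `ω^𝔻_f` of a doubled Weil representation `ω ∘ s^𝔻`
# — the tensor factorisation `ω(s^𝔻(ι k_f))(Φ_∞ ⊗ Φ_f) = Φ_∞ ⊗ ω^𝔻_f(k_f)Φ_f` and SMOOTHNESS (every `Φ_f` is fixed by a principal congruence level)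

Cell `pub/hodgecm-mathlib` (D-0151), Track B, build stream 29; binder sheet `K2/K2E5-plan/g6/SIGS-RoadI-v3.md` §2 U2f («every `x ∈ 𝒮_f ⊗ V_∞` … each `x_w` fixed by an
open compact … has finite-dimensional `𝒦.K`-orbit span under `adelicMpCont.omega … (doubledWeilRep …)`»).  The archimedean half is ★ `K2LiuDoubledWeilRepArchPinned.omega_sD_archToAdelic_tmul`;
this file is the FINITE half, for ANY `χ`-normalised doubled Weil representation `s^𝔻` (★ `IsDoubledWeilRep χ sD`; the concrete ★ `doubledWeilRep` via ★ `isDoubledWeilRep_doubledWeilRep`)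
of ANY doubled datum `(e : Fin N × Fin M ≃ Fin n, dV, dW)` — in particular #42F′'s big datum `(e′, dV, tensorFrame dW eW dV′)`.  Everything is an INSTANCE of the tree's generic finite-factor
theory ★ `Weil1964.finRepMp` ([Weil1964, Chap. III n° 37–38]: `𝐫_𝐀 = ⊗_v 𝐫_v`; pairs fixing the archimedean vectors act by `1 ⊗ B`) at the hypothesis `harch`, which for `s^𝔻 ∘ ι`
(`ι = finAdelicToAdelic`) is `π(s^𝔻(ι k_f)) = ι^𝔻(1, k_f)` (★ `IsDoubledWeilRep.proj_eq`) fixing the vectors with zero finite components (★ `adelicToSymplectic_finAdelicToAdelic_apply_eq_self`):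

* §1 `proj_sD_finAdelicToAdelic_apply_archVec` — `harch` for `s^𝔻 ∘ ι`; so `ω^𝔻_f := finRepMp (isUnit_gramDA) (sD ∘ ι) harch` is THE finite Weil representation of `H(𝔸_f) = U(𝔻)(𝔸_f)`
  on `𝒮((𝔸_f)^{n+n})`, and **`omega_sD_finAdelicToAdelic_tmul`**: `ω(s^𝔻(ι k_f)) E(Φ_∞ ⊗ Φ_f) = E(Φ_∞ ⊗ ω^𝔻_f(k_f) Φ_f)` (`E = piSchwartzBruhatEquiv`);
  **`omega_sD_archToAdelic_mul_finAdelicToAdelic_tmul`**: `ω(s^𝔻((k_∞,1)(1,k_f))) E(Φ_∞ ⊗ Φ_f) = ω(s^𝔻(k_∞,1)) E(Φ_∞ ⊗ ω^𝔻_f(k_f) Φ_f)`; and for a general `g ∈ H(𝔸)`,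
  **`omega_sD_tmul_eq`**: `ω(s^𝔻 g) E(Φ_∞ ⊗ Φ_f) = ω(s^𝔻(g_∞,1)) E(Φ_∞ ⊗ ω^𝔻_f(g_f) Φ_f)` (★ `archToAdelic_mul_finAdelicToAdelic`).
* §2 SMOOTHNESS (no hypothesis on `Φ_f`): **`exists_finCongruenceLevel_forall_finRepMp_sD_apply_eq_self`** — every `Φ_f ∈ 𝒮((𝔸_f)^{n+n})` is FIXED by `ω^𝔻_f` on a principal
  congruence level `K_{H,f}(𝔪)`, `𝔪 ≠ 0` (★ engine `WeilCoinv.exists_finCongruenceLevel_forall_finRepMp_apply_eq_self`: coset decomposition + level fixing of coset indicators +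
  no small subgroups); **`exists_finCongruenceLevel_forall_omega_sD_tmul_eq_self`** — hence `ω(s^𝔻(ι k_f)) E(Φ_∞ ⊗ Φ_f) = E(Φ_∞ ⊗ Φ_f)` for all `Φ_∞` and all `k_f ∈ K_{H,f}(𝔪)`:
  the clause «each `x_w` fixed by an open compact» of SIGS U2f holds for EVERY finite Schwartz–Bruhat vector, for free.

No definition, no instance, no named fact, no `sorry`; axioms ⊆ {propext, Classical.choice, Quot.sound}.  HONEST LABEL: HC_CM is proved only modulo the 7 printed citations
(2 remaining named inputs: hLiu418 = stmt-HodgeConjecture-24832, h413 = stmt-HodgeConjecture-24833) until rung 0 closes; `--supports stmt-HodgeConjecture-24832` helper, count-neutral.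
References: [Weil1964] A. Weil, Acta Math. 111 (1964), Chap. III n° 37–39 pp. 187–190; [GelbartRogawski1991] S. Gelbart, J. Rogawski, Invent. Math. 105 (1991), §3.1 p. 454,
Prop. 3.1.1 p. 455; [MoeglinVignerasWaldspurger1987] C. Mœglin, M.-F. Vignéras, J.-L. Waldspurger, LNM 1291, Chap. 2 I.3, II.2; [BorelJacquet1979] A. Borel, H. Jacquet,
PSPM 33.1 (1979), §4.1 (`g = g_∞ g_f`); [Kudla1994] S. Kudla, Israel J. Math. 87 (1994), §2, Thm. 3.1.
-/

set_option autoImplicit false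
set_option linter.dupNamespace false
set_option Elab.async false

noncomputable section

open scoped Matrix TensorProduct SchwartzMap Classical
open NumberField NumberField.mixedEmbedding IsDedekindDomain

namespace Summit.HodgeConjecture.HodgeConjecture.Cruxes.HLiu418.K2LiuDoubledWeilRepFinHalf

open Literature.NumberTheory.Automorphic Literature.NumberTheory.Automorphic.UnitaryGroup
open Literature.NumberTheory.GaloisRepresentations
open Literature.NumberTheory.GelbartRogawski1991 Literature.NumberTheory.GelbartRogawski1991.UnitaryDualPair
open Literature.NumberTheory.GelbartRogawski1991.GRConstruction
open Literature.NumberTheory.Weil1964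

variable (L : Type) [Field L] [NumberField L] [IsCMField L]
variable {N M n : ℕ} (e : Fin N × Fin M ≃ Fin n)
  (dV : Fin N → L) (hdV : ∀ i, IsCMField.complexConj L (dV i) = dV i) (hdV0 : ∀ i, dV i ≠ 0)
  (dW : Fin M → L) (hdW : ∀ i, IsCMField.complexConj L (dW i) = dW i) (hdW0 : ∀ i, dW i ≠ 0)
  {χ : HeckeCharacter L} {sD : HA L e dV hdV dW hdW →* MpD L e dV hdV dW hdW}
  (hsD : IsDoubledWeilRep L e dV hdV hdV0 dW hdW hdW0 χ sD)

/-! ## §1 `harch` for `s^𝔻 ∘ ι` and the tensor factorisation on pure tensors -/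

include hsD in
/-- **`harch` for the finite-adelic points of a doubled Weil representation**: the symplectic component `π(s^𝔻(ι k_f)) = ι^𝔻(1, k_f)` (★ `IsDoubledWeilRep.proj_eq`) FIXES every
archimedean vector `(archVec a, archVec w)` of `𝕎^𝔻_𝔸` (★ `adelicToSymplectic_finAdelicToAdelic_apply_eq_self`: an adelic point with archimedean component `1` fixes the vectors with
zero finite components) — the hypothesis of ★ `Weil1964.finRepMp ∕ omega_map_tmul_finRepMp ∕ FiniteWeilLevelFixing` at `s := s^𝔻 ∘ ι`.
[cite: GelbartRogawski1991, §3.1 p. 454, Prop. 3.1.1 p. 455] [cite: Weil1964, Chap. III n° 37–38 pp. 188–190] -/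
theorem proj_sD_finAdelicToAdelic_apply_archVec
    (k : UnitaryGroup.finAdelic (Fp L) L (IsCMField.complexConj L) (n + n) (hermD L e dV hdV dW hdW)) (a w : Fin (n + n) → mixedSpace (Fp L)) :
    (adelicMpCont.proj (Fp L) (Fin (n + n)) (gramDA L e dV hdV dW hdW)
        ((sD.comp (UnitaryGroup.finAdelicToAdelic (Fp L) L (IsCMField.complexConj L) (n + n) (hermD L e dV hdV dW hdW))) k)).1
        (archVec (Fp L) (Fin (n + n)) a, archVec (Fp L) (Fin (n + n)) w) =
      (archVec (Fp L) (Fin (n + n)) a, archVec (Fp L) (Fin (n + n)) w) := by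
  have hproj : adelicMpCont.proj (Fp L) (Fin (n + n)) (gramDA L e dV hdV dW hdW)
      ((sD.comp (UnitaryGroup.finAdelicToAdelic (Fp L) L (IsCMField.complexConj L) (n + n) (hermD L e dV hdV dW hdW))) k) =
      toSpD L e dV hdV dW hdW (UnitaryGroup.finAdelicToAdelic (Fp L) L (IsCMField.complexConj L) (n + n) (hermD L e dV hdV dW hdW) k) :=
    hsD.proj_eq _
  rw [hproj]
  exact UnitaryGroup.adelicToSymplectic_finAdelicToAdelic_apply_eq_self (Fp L) L (IsCMField.complexConj L) (n + n)
    (complexConj_imagUnit L) (imagUnit_ne_zero L) (imagUnit_mul_self L) (gramD_isSymm L e dV hdV dW hdW) rfl k _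
    (fun i => archVec_apply_snd a i) (fun i => archVec_apply_snd w i)

set_option maxHeartbeats 1000000 in -- the adelic metaplectic carrier telescope
/-- **THE FINITE HALF ON PURE TENSORS**: `ω(s^𝔻(ι k_f)) E(Φ_∞ ⊗ Φ_f) = E(Φ_∞ ⊗ ω^𝔻_f(k_f) Φ_f)`, where `ω^𝔻_f := finRepMp (isUnit_gramDA) (s^𝔻 ∘ ι) harch` is the finite Weil
representation of `H(𝔸_f) = U(𝔻)(𝔸_f)` on `𝒮((𝔸_f)^{n+n})` and `E = piSchwartzBruhatEquiv` (★ `omega_map_tmul_finRepMp`).  Twin of the archimedean half ★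
`K2LiuDoubledWeilRepArchPinned.omega_sD_archToAdelic_tmul`. [cite: Weil1964, Chap. III n° 37–38 pp. 188–190] [cite: GelbartRogawski1991, §3.1 Prop. 3.1.1 p. 455] -/
theorem omega_sD_finAdelicToAdelic_tmul
    (k : UnitaryGroup.finAdelic (Fp L) L (IsCMField.complexConj L) (n + n) (hermD L e dV hdV dW hdW))
    (a : 𝓢(((Fin (n + n)) → mixedSpace (Fp L)), ℂ)) (f : FinSB (Fp L) (Fin (n + n))) :
    adelicMpCont.omega (Fp L) (Fin (n + n)) (gramDA L e dV hdV dW hdW)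
        (sD (UnitaryGroup.finAdelicToAdelic (Fp L) L (IsCMField.complexConj L) (n + n) (hermD L e dV hdV dW hdW) k))
        (piSchwartzBruhatEquiv (Fp L) (Fin (n + n)) (a ⊗ₜ[ℂ] f)) =
      piSchwartzBruhatEquiv (Fp L) (Fin (n + n)) (a ⊗ₜ[ℂ]
        finRepMp (DoubledWeilUniqueness.isUnit_gramDA L e dV hdV hdV0 dW hdW hdW0)
          (sD.comp (UnitaryGroup.finAdelicToAdelic (Fp L) L (IsCMField.complexConj L) (n + n) (hermD L e dV hdV dW hdW)))
          (proj_sD_finAdelicToAdelic_apply_archVec L e dV hdV hdV0 dW hdW hdW0 hsD) k f) :=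
  omega_map_tmul_finRepMp (DoubledWeilUniqueness.isUnit_gramDA L e dV hdV hdV0 dW hdW hdW0)
    (sD.comp (UnitaryGroup.finAdelicToAdelic (Fp L) L (IsCMField.complexConj L) (n + n) (hermD L e dV hdV dW hdW)))
    (proj_sD_finAdelicToAdelic_apply_archVec L e dV hdV hdV0 dW hdW hdW0 hsD) k a f

set_option maxHeartbeats 1000000 in -- idem
/-- **`(k_∞, 1)·(1, k_f)` on pure tensors**: `ω(s^𝔻((k_∞,1)(1,k_f))) E(Φ_∞ ⊗ Φ_f) = ω(s^𝔻(k_∞,1)) E(Φ_∞ ⊗ ω^𝔻_f(k_f) Φ_f)` — the archimedean element acts on the left factor only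
(★ `omega_sD_archToAdelic_tmul`), the finite one on the right factor only.  (The product is typed in `H(𝔸) = HA`, whose instances are the adelic datum's up to unfolding —
cf. ★ `DoubledWeilUniqueness`; term-mode proof.) [cite: Weil1964, Chap. III n° 37–38 pp. 188–190] [cite: BorelJacquet1979, §4.1] -/
theorem omega_sD_archToAdelic_mul_finAdelicToAdelic_tmul
    (kinf : UnitaryGroup.arch (Fp L) L (IsCMField.complexConj L) (n + n) (hermD L e dV hdV dW hdW))
    (k : UnitaryGroup.finAdelic (Fp L) L (IsCMField.complexConj L) (n + n) (hermD L e dV hdV dW hdW))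
    (a : 𝓢(((Fin (n + n)) → mixedSpace (Fp L)), ℂ)) (f : FinSB (Fp L) (Fin (n + n))) :
    adelicMpCont.omega (Fp L) (Fin (n + n)) (gramDA L e dV hdV dW hdW)
        (sD ((UnitaryGroup.archToAdelic (Fp L) L (IsCMField.complexConj L) (n + n) (hermD L e dV hdV dW hdW) kinf : HA L e dV hdV dW hdW) *
          (UnitaryGroup.finAdelicToAdelic (Fp L) L (IsCMField.complexConj L) (n + n) (hermD L e dV hdV dW hdW) k : HA L e dV hdV dW hdW)))
        (piSchwartzBruhatEquiv (Fp L) (Fin (n + n)) (a ⊗ₜ[ℂ] f)) =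
      adelicMpCont.omega (Fp L) (Fin (n + n)) (gramDA L e dV hdV dW hdW)
        (sD (UnitaryGroup.archToAdelic (Fp L) L (IsCMField.complexConj L) (n + n) (hermD L e dV hdV dW hdW) kinf))
        (piSchwartzBruhatEquiv (Fp L) (Fin (n + n)) (a ⊗ₜ[ℂ]
          finRepMp (DoubledWeilUniqueness.isUnit_gramDA L e dV hdV hdV0 dW hdW hdW0)
            (sD.comp (UnitaryGroup.finAdelicToAdelic (Fp L) L (IsCMField.complexConj L) (n + n) (hermD L e dV hdV dW hdW)))
            (proj_sD_finAdelicToAdelic_apply_archVec L e dV hdV hdV0 dW hdW hdW0 hsD) k f)) :=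
  (congrArg (fun q => adelicMpCont.omega (Fp L) (Fin (n + n)) (gramDA L e dV hdV dW hdW) q (piSchwartzBruhatEquiv (Fp L) (Fin (n + n)) (a ⊗ₜ[ℂ] f)))
      (map_mul sD _ _)).trans <|
    (congrArg (fun T => T (piSchwartzBruhatEquiv (Fp L) (Fin (n + n)) (a ⊗ₜ[ℂ] f)))
      (map_mul (adelicMpCont.omega (Fp L) (Fin (n + n)) (gramDA L e dV hdV dW hdW)) _ _)).trans <|
    (Module.End.mul_apply _ _ _).trans <|
    congrArg (fun Ψ => adelicMpCont.omega (Fp L) (Fin (n + n)) (gramDA L e dV hdV dW hdW)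
        (sD (UnitaryGroup.archToAdelic (Fp L) L (IsCMField.complexConj L) (n + n) (hermD L e dV hdV dW hdW) kinf)) Ψ)
      (omega_sD_finAdelicToAdelic_tmul L e dV hdV hdV0 dW hdW hdW0 hsD k a f)

set_option maxHeartbeats 1000000 in -- idem
/-- **`g = (g_∞,1)·(1,g_f)` on pure tensors**: for every `g ∈ H(𝔸)`, `ω(s^𝔻 g) E(Φ_∞ ⊗ Φ_f) = ω(s^𝔻(g_∞, 1)) E(Φ_∞ ⊗ ω^𝔻_f(g_f) Φ_f)` with `g_∞ = archPart g`, `g_f = finPart g`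
(★ `archToAdelic_mul_finAdelicToAdelic`). [cite: BorelJacquet1979, §4.1] [cite: Weil1964, Chap. III n° 37–38 pp. 188–190] -/
theorem omega_sD_tmul_eq (g : HA L e dV hdV dW hdW) (a : 𝓢(((Fin (n + n)) → mixedSpace (Fp L)), ℂ)) (f : FinSB (Fp L) (Fin (n + n))) :
    adelicMpCont.omega (Fp L) (Fin (n + n)) (gramDA L e dV hdV dW hdW) (sD g) (piSchwartzBruhatEquiv (Fp L) (Fin (n + n)) (a ⊗ₜ[ℂ] f)) =
      adelicMpCont.omega (Fp L) (Fin (n + n)) (gramDA L e dV hdV dW hdW)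
        (sD (UnitaryGroup.archToAdelic (Fp L) L (IsCMField.complexConj L) (n + n) (hermD L e dV hdV dW hdW)
          (UnitaryGroup.archPart (Fp L) L (IsCMField.complexConj L) (n + n) (hermD L e dV hdV dW hdW) g)))
        (piSchwartzBruhatEquiv (Fp L) (Fin (n + n)) (a ⊗ₜ[ℂ]
          finRepMp (DoubledWeilUniqueness.isUnit_gramDA L e dV hdV hdV0 dW hdW hdW0)
            (sD.comp (UnitaryGroup.finAdelicToAdelic (Fp L) L (IsCMField.complexConj L) (n + n) (hermD L e dV hdV dW hdW)))
            (proj_sD_finAdelicToAdelic_apply_archVec L e dV hdV hdV0 dW hdW hdW0 hsD)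
            (UnitaryGroup.finPart (Fp L) L (IsCMField.complexConj L) (n + n) (hermD L e dV hdV dW hdW) g) f)) := by
  -- `g = (g_∞, 1) · (1, g_f)`, re-typed in `H(𝔸) = HA`
  have hg : (UnitaryGroup.archToAdelic (Fp L) L (IsCMField.complexConj L) (n + n) (hermD L e dV hdV dW hdW)
        (UnitaryGroup.archPart (Fp L) L (IsCMField.complexConj L) (n + n) (hermD L e dV hdV dW hdW) g) : HA L e dV hdV dW hdW) *
      (UnitaryGroup.finAdelicToAdelic (Fp L) L (IsCMField.complexConj L) (n + n) (hermD L e dV hdV dW hdW)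
        (UnitaryGroup.finPart (Fp L) L (IsCMField.complexConj L) (n + n) (hermD L e dV hdV dW hdW) g) : HA L e dV hdV dW hdW) = g :=
    UnitaryGroup.archToAdelic_mul_finAdelicToAdelic (Fp L) L (IsCMField.complexConj L) (n + n) (hermD L e dV hdV dW hdW) g
  exact (congrArg (fun q => adelicMpCont.omega (Fp L) (Fin (n + n)) (gramDA L e dV hdV dW hdW) (sD q)
      (piSchwartzBruhatEquiv (Fp L) (Fin (n + n)) (a ⊗ₜ[ℂ] f))) hg).symm.trans
    (omega_sD_archToAdelic_mul_finAdelicToAdelic_tmul L e dV hdV hdV0 dW hdW hdW0 hsD _ _ a f)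

/-! ## §2 Smoothness: every finite Schwartz–Bruhat vector is fixed by a principal congruence level -/

set_option maxHeartbeats 1000000 in -- idem
/-- **`ω^𝔻_f` IS SMOOTH**: every `Φ_f ∈ 𝒮((𝔸_f)^{n+n})` is FIXED by the finite Weil representation `ω^𝔻_f = finRepMp (s^𝔻 ∘ ι)` on some principal congruence level `K_{H,f}(𝔪)`,
`𝔪 ≠ 0` an ideal of `𝓞_L` (★ `UnitaryGroup.finCongruenceLevel`; open and compact) — ★ engine `WeilCoinv.exists_finCongruenceLevel_forall_finRepMp_apply_eq_self` at the
continuous `s^𝔻 ∘ ι` (★ `IsDoubledWeilRep.continuous`, ★ `continuous_finAdelicToAdelic`) and §1 `harch`. [cite: GelbartRogawski1991, §3.1 p. 454]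
[cite: MoeglinVignerasWaldspurger1987, Chap. 2 I.3, II.2] [cite: Weil1964, Chap. III n° 37–39 pp. 187–190] -/
theorem exists_finCongruenceLevel_forall_finRepMp_sD_apply_eq_self (f : FinSB (Fp L) (Fin (n + n))) :
    ∃ 𝔪 : Ideal (𝓞 L), 𝔪 ≠ 0 ∧
      ∀ k ∈ UnitaryGroup.finCongruenceLevel (Fp L) L (IsCMField.complexConj L) (n + n) (hermD L e dV hdV dW hdW) 𝔪,
        finRepMp (DoubledWeilUniqueness.isUnit_gramDA L e dV hdV hdV0 dW hdW hdW0)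
            (sD.comp (UnitaryGroup.finAdelicToAdelic (Fp L) L (IsCMField.complexConj L) (n + n) (hermD L e dV hdV dW hdW)))
            (proj_sD_finAdelicToAdelic_apply_archVec L e dV hdV hdV0 dW hdW hdW0 hsD) k f = f :=
  WeilCoinv.exists_finCongruenceLevel_forall_finRepMp_apply_eq_self (DoubledWeilUniqueness.isUnit_gramDA L e dV hdV hdV0 dW hdW hdW0)
    (sD.comp (UnitaryGroup.finAdelicToAdelic (Fp L) L (IsCMField.complexConj L) (n + n) (hermD L e dV hdV dW hdW)))
    (hsD.continuous.comp (UnitaryGroup.continuous_finAdelicToAdelic (Fp L) L (IsCMField.complexConj L) (n + n) (hermD L e dV hdV dW hdW)))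
    (proj_sD_finAdelicToAdelic_apply_archVec L e dV hdV hdV0 dW hdW hdW0 hsD) f

include hsD in
set_option maxHeartbeats 1000000 in -- idem
/-- **EVERY PURE TENSOR `Φ_∞ ⊗ Φ_f` IS FIXED BY `ω(s^𝔻(ι k_f))` ON A PRINCIPAL CONGRUENCE LEVEL** (one level for all `Φ_∞`): there is `𝔪 ≠ 0` with
`ω(s^𝔻(ι k_f)) E(Φ_∞ ⊗ Φ_f) = E(Φ_∞ ⊗ Φ_f)` for all `Φ_∞ ∈ 𝓢((L⁺ ⊗ ℝ)^{n+n})` and all `k_f ∈ K_{H,f}(𝔪)` — the clause «`x_f` fixed by an open compact» of SIGS U2f, for free.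
[cite: GelbartRogawski1991, §3.1 p. 454] [cite: Weil1964, Chap. III n° 37–39 pp. 187–190] -/
theorem exists_finCongruenceLevel_forall_omega_sD_tmul_eq_self (f : FinSB (Fp L) (Fin (n + n))) :
    ∃ 𝔪 : Ideal (𝓞 L), 𝔪 ≠ 0 ∧
      ∀ k ∈ UnitaryGroup.finCongruenceLevel (Fp L) L (IsCMField.complexConj L) (n + n) (hermD L e dV hdV dW hdW) 𝔪,
        ∀ a : 𝓢(((Fin (n + n)) → mixedSpace (Fp L)), ℂ),
          adelicMpCont.omega (Fp L) (Fin (n + n)) (gramDA L e dV hdV dW hdW)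
              (sD (UnitaryGroup.finAdelicToAdelic (Fp L) L (IsCMField.complexConj L) (n + n) (hermD L e dV hdV dW hdW) k))
              (piSchwartzBruhatEquiv (Fp L) (Fin (n + n)) (a ⊗ₜ[ℂ] f)) =
            piSchwartzBruhatEquiv (Fp L) (Fin (n + n)) (a ⊗ₜ[ℂ] f) := by
  -- (`have` + `Exists.imp`: `obtain … := <this application>` trips a slow `isDefEq` in `generalize`, cf. ★ `FiniteWeilLevelFixing`)
  have hex := exists_finCongruenceLevel_forall_finRepMp_sD_apply_eq_self L e dV hdV hdV0 dW hdW hdW0 hsD f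
  exact hex.imp fun 𝔪 h => ⟨h.1, fun k hk a => (omega_sD_finAdelicToAdelic_tmul L e dV hdV hdV0 dW hdW hdW0 hsD k a f).trans
    (congrArg (fun Ψ => piSchwartzBruhatEquiv (Fp L) (Fin (n + n)) (a ⊗ₜ[ℂ] Ψ)) (h.2 k hk))⟩

end Summit.HodgeConjecture.HodgeConjecture.Cruxes.HLiu418.K2LiuDoubledWeilRepFinHalf

end
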